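import Literature.AlgebraicGeometry.Motives.HodgeStructurePicardNumberSymmetricEndomorphisms
import Literature.AlgebraicGeometry.Motives.HodgeStructureLefschetzGroupDirectSum
import Literature.AlgebraicGeometry.Motives.HodgeStructureQuotient
import Literature.AlgebraicGeometry.Motives.HodgeStructureOfCMTypeSubHodgeStructures
import HarnessLib

/-!
# The Picard number of a direct sum of polarized `ℚ`-Hodge structures of odd weight:
# `ρ(H₁ ⊕ H₂) = ρ(H₁) + ρ(H₂) + dim_ℚ Hom_HS(H₁, H₂)` — the `†`-symmetric Hodge endomorphisms of `H₁ ⊕ H₂` in blocks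

[topic AlgebraicGeometry/Motives]

Layer `Literature/AlgebraicGeometry/Motives`, lane `lit-hodgefound` (Track 2 foundations library; seat `lit-hodgefound-p34`,
generation 26, self-proposed row g26-#5 of `run/shared/lean/pub/lit-hodgefound/SKELETON.md`). THEOREMS ONLY (no definition,
no named fact; net debt `0`). Sequel of g26-#3 `Motives/HodgeStructurePicardNumberSymmetricEndomorphisms` (`ρ(H) :=
dim_ℚ Hdgⁿ(⋀² H) = dim_ℚ E_φ^s`, `E_φ^s = {a ∈ E_φ | a† = a}` the `†`-symmetric Hodge endomorphisms) on the DIRECT SUM `H₁ ⊕ H₂`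
(`HodgeStructure.prod`) with the direct-sum polarization `Q₁ ⊕ Q₂` (`Polarization.prod`, `Q((v, w), (v′, w′)) = Q₁(v, v′) +
Q₂(w, w′)`); CARRIER: `V₁ × V₂`, endomorphisms in `2 × 2` blocks through `LinearMap.fst/snd/inl/inr` (g18-#3
`Motives/HodgeStructureCentralizerDirectSum` §0: the blocks of a Hodge endomorphism of `H₁ ⊕ H₂` are Hodge endomorphisms /
morphisms `H₁ → H₂`, `H₂ → H₁`), the involution in blocks (g18-#4 `Polarization.adjoint_prod_prodMap`).

## The source, verbatim

H. Lange, *Abelian Varieties over the Complex Numbers* (2023) [Lange2023AbelianVarietiesComplex], §2.4.2 Prop. 2.4.12 (a) (held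
text chunk p0118): "`φ : NS_ℚ(X) → End^s_ℚ(X)`, `L ↦ φ_{L₀}⁻¹ φ_L` is an isomorphism of `ℚ`-vector spaces" (with `X = X₁ × X₂`,
`L₀ = p₁^*L₁ ⊗ p₂^*L₂`: Exercise 2.4.5 (8), chunk p0126 L5, "`p₁^*L₁ ⊗ p₂^*L₂` is a polarization on `X₁ × X₂`"). K. Hulek,
R. Laface, *On the Picard numbers of abelian varieties*, Ann. Sc. Norm. Super. Pisa (2019) [HulekLaface2019PicardNumbersAV]
(held `paper:arxiv-1703.05882` chunk p0005), §2.1 "Additivity of the Picard number for non-isogeneous products":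
"**Proposition 2.2.** Let `A₁, …, A_r` be simple abelian varieties, such that `A_i` is not isogenous to `A_j` for `i ≠ j`. Then
the (exterior) pullback of line bundles yields an isomorphism `∏ Pic(A_i^{n_i}) ≅ Pic(∏ A_i^{n_i})`. […] Clearly, exterior
pull-back of line bundles always yields an injective map, but surjectivity is a special feature. In fact, if `E` is an
elliptic curve, the abelian surface `E × E` has Picard number `ρ ∈ {3, 4}`, depending on the presence of CM. […] Hence
`Hom(A_i, A_j) = Hom(A_i, A_j^∨) = 0` and every isogeny `f : ∏ A_i^{n_i} → (∏ A_i^{n_i})^∨` is of the form `f = (f_1, …, f_r)`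
[…] **Corollary 2.3.** […] `ρ(∏ A_i^{n_i}) = Σ ρ(A_i^{n_i})`." The general count: a `†`-symmetric endomorphism of `X₁ × X₂`
is a block matrix `(a, b; c, d)` with `a′ = a`, `d′ = d`, `b = c′` (`c ∈ Hom⁰(X₁, X₂)` arbitrary, `c′` its transpose for
`(L₁, L₂)`), whence `End^s_ℚ(X₁ × X₂) ≅ End^s_ℚ(X₁) ⊕ End^s_ℚ(X₂) ⊕ Hom⁰(X₁, X₂)` and the classical
`ρ(X₁ × X₂) = ρ(X₁) + ρ(X₂) + rank Hom(X₁, X₂)` (`E × E`: `2 + rank End(E) ∈ {3, 4}`).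

## What is PROVED (`E = (H₁.prod H₂).endAlg`, `Q = Q₁.prod Q₂`, `Eˢ(·) = span{a ∈ E_φ | a† = a}` as in g26-#3; same weight `n`)

* §1 BLOCKS AND THE INVOLUTION (any weight): `Polarization.form_toDualEquiv_symm_dualMap_toDualEquiv` (the TRANSPOSE
  `cᵗ = θ₁⁻¹ ∘ c^∨ ∘ θ₂ : V₂ → V₁` of `c : V₁ → V₂` for `(Q₁, Q₂)`: `Q₁(cᵗ w, v) = Q₂(w, c v)`),
  **`Polarization.adjoint_prod_inr_comp_comp_fst`** (`(inr ∘ c ∘ fst)† = inl ∘ cᵗ ∘ snd` for `Q₁ ⊕ Q₂`),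
  `Polarization.adjoint_prod_inl_comp_comp_fst` / `…inr_comp_comp_snd` (diagonal blocks: `(inl a fst)† = inl a† fst`, …).
* §2 `Eˢ(H₁ ⊕ H₂)` IN BLOCKS (any weight): `Polarization.fst_comp_comp_inl_mem_span_of_mem_span_prod` /
  `…snd_comp_comp_inr_mem_span_of_mem_span_prod` (diagonal blocks of a symmetric Hodge endomorphism are symmetric Hodge
  endomorphisms), `…fst_comp_comp_inr_eq_of_mem_span_prod` (the `(1,2)`-block is the transpose of the `(2,1)`-block),
  **`Polarization.exists_linearEquiv_span_prod`** (a `ℚ`-linear isomorphism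
  `(Eˢ(H₁) × Eˢ(H₂)) × Hom(H₁, H₂) ≃ Eˢ(H₁ ⊕ H₂)`, `((a, d), c) ↦ (a, cᵗ; c, d)`),
  **`Polarization.finrank_span_prod`** (`dim Eˢ(H₁ ⊕ H₂) = dim Eˢ(H₁) + dim Eˢ(H₂) + dim Hom(H₁, H₂)`).
* §3 THE PICARD NUMBER OF A DIRECT SUM (odd weight): **`Polarization.finrank_hodgeClasses_two_prod`**
  (`ρ(H₁ ⊕ H₂) = ρ(H₁) + ρ(H₂) + dim_ℚ Hom_HS(H₁, H₂)`), `…finrank_hodgeClasses_two_prod_of_subsingleton_hom` (Hulek–Laface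
  Cor. 2.3, binary case: `Hom(H₁, H₂) = 0 ⟹ ρ(H₁ ⊕ H₂) = ρ(H₁) + ρ(H₂)`), **`…finrank_hodgeClasses_two_prod_self`** (`ρ(H ⊕ H) = 2ρ(H) + dim_ℚ E_φ(H)`, with the tree's
  `finrank_endAlg_eq_finrank_hom`; `E × E`: `ρ = 2 + rank End(E) ∈ {3, 4}`).

## Lean encoding, differences

`NS_ℚ(X)` is `Hdgⁿ(⋀² H)` for `H = H¹(X, ℚ)` and `ρ(X) = dim_ℚ` of it (g26-#3); `Hom(X₁, X₂) ⊗ ℚ = Hom_HS(H₁, H₂)` (the tree's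
`HodgeStructure.Hom` with its `ℚ`-module structure of `Motives/HodgeStructureQuotient`); the transpose `cᵗ` is spelled
`θ₁⁻¹ ∘ c^∨ ∘ θ₂` with `θᵢ = Qᵢ.toDualEquiv` (no new definition). Hulek–Laface's Prop. 2.2 is about `Pic` (integral, with
`Pic⁰`); here only the rational Néron–Severi part, for two summands (`r = 2`; iterate for more).

## References
* [Lange2023AbelianVarietiesComplex] H. Lange, *Abelian Varieties over the Complex Numbers* (2023), §2.4.2 Prop. 2.4.12 (a)
  (chunk p0118), Exercise 2.4.5 (8) (chunk p0126).
* [HulekLaface2019PicardNumbersAV] K. Hulek, R. Laface, *On the Picard numbers of abelian varieties*, Ann. Sc. Norm. Super.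
  Pisa Cl. Sci. (5) 19 (2019), §2.1 Prop. 2.2, Cor. 2.3 (arXiv:1703.05882 chunk p0005).
* [Milne1999LefschetzClasses] J. S. Milne, *Lefschetz classes on abelian varieties*, Duke Math. J. 96 (1999), §1 p. 643
  L21–L27 (the involution on `C(A₁ × A₂)`).
* [DeligneHodgeII1971] P. Deligne, *Théorie de Hodge II*, Publ. Math. IHÉS 40 (1971), 2.1 (morphisms, direct sums).
-/

open scoped TensorProduct

namespace Literature.AlgebraicGeometry.Motives

namespace HodgeStructure

universe u

variable {V₁ : Type u} [AddCommGroup V₁] [Module ℚ V₁] [Module.Finite ℚ V₁] {V₂ : Type u} [AddCommGroup V₂] [Module ℚ V₂]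
  [Module.Finite ℚ V₂] {n : ℤ} {H₁ : HodgeStructure V₁ n} {H₂ : HodgeStructure V₂ n}
  (Q₁ : Polarization H₁) (Q₂ : Polarization H₂)

/-! ### §1 Blocks of `End(V₁ × V₂)` and the involution of `Q₁ ⊕ Q₂` -/

omit [Module.Finite ℚ V₁] [Module.Finite ℚ V₂] in
/-- Block decomposition `a = (a₁₁, a₁₂; a₂₁, a₂₂)` of an endomorphism of `V₁ × V₂`. Private plumbing. [folklore] -/
private theorem eq_sum_blocks (a : Module.End ℚ (V₁ × V₂)) :
    a = LinearMap.inl ℚ V₁ V₂ ∘ₗ (LinearMap.fst ℚ V₁ V₂ ∘ₗ a ∘ₗ LinearMap.inl ℚ V₁ V₂) ∘ₗ LinearMap.fst ℚ V₁ V₂ +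
      LinearMap.inl ℚ V₁ V₂ ∘ₗ (LinearMap.fst ℚ V₁ V₂ ∘ₗ a ∘ₗ LinearMap.inr ℚ V₁ V₂) ∘ₗ LinearMap.snd ℚ V₁ V₂ +
      LinearMap.inr ℚ V₁ V₂ ∘ₗ (LinearMap.snd ℚ V₁ V₂ ∘ₗ a ∘ₗ LinearMap.inl ℚ V₁ V₂) ∘ₗ LinearMap.fst ℚ V₁ V₂ +
      LinearMap.inr ℚ V₁ V₂ ∘ₗ (LinearMap.snd ℚ V₁ V₂ ∘ₗ a ∘ₗ LinearMap.inr ℚ V₁ V₂) ∘ₗ LinearMap.snd ℚ V₁ V₂ := by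
  refine LinearMap.ext fun x ↦ ?_
  have hx : x = LinearMap.inl ℚ V₁ V₂ x.1 + LinearMap.inr ℚ V₁ V₂ x.2 := by
    rw [LinearMap.inl_apply, LinearMap.inr_apply, Prod.mk_add_mk, add_zero, zero_add]
  conv_lhs => rw [hx, map_add]
  ext <;> simp only [LinearMap.add_apply, LinearMap.comp_apply, LinearMap.fst_apply, LinearMap.snd_apply,
    LinearMap.inl_apply, LinearMap.inr_apply, Prod.fst_add, Prod.snd_add, add_zero, zero_add]

/-- **The transpose `cᵗ = θ₁⁻¹ ∘ c^∨ ∘ θ₂ : V₂ → V₁` of `c : V₁ → V₂`** for the pair `(Q₁, Q₂)` (`θᵢ v = Qᵢ(v, ·)`):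
`Q₁(cᵗ w, v) = Q₂(w, c v)` — the rational form of `φ_{L₁}⁻¹ ∘ ĉ ∘ φ_{L₂}`. [cite: Lange2023AbelianVarietiesComplex, §2.4.2 Prop. 2.4.12 (chunk p0118)] -/
theorem Polarization.form_toDualEquiv_symm_dualMap_toDualEquiv_apply (c : V₁ →ₗ[ℚ] V₂) (w : V₂) (v : V₁) :
    Q₁.form (Q₁.toDualEquiv.symm (c.dualMap (Q₂.toDualEquiv w))) v = Q₂.form w (c v) := by
  rw [Q₁.form_toDualEquiv_symm, LinearMap.dualMap_apply, Q₂.toDualEquiv_apply]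

/-- The same for the composite map `θ₁⁻¹ ∘ c^∨ ∘ θ₂`. [cite: Lange2023AbelianVarietiesComplex, §2.4.2 Prop. 2.4.12 (chunk p0118)] -/
theorem Polarization.form_toDualEquiv_symm_dualMap_toDualEquiv (c : V₁ →ₗ[ℚ] V₂) (w : V₂) (v : V₁) :
    Q₁.form (((Q₁.toDualEquiv.symm : Module.Dual ℚ V₁ →ₗ[ℚ] V₁) ∘ₗ c.dualMap ∘ₗ
      (Q₂.toDualEquiv : V₂ →ₗ[ℚ] Module.Dual ℚ V₂)) w) v = Q₂.form w (c v) := by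
  rw [LinearMap.comp_apply, LinearMap.comp_apply, LinearEquiv.coe_coe, LinearEquiv.coe_coe,
    Q₁.form_toDualEquiv_symm_dualMap_toDualEquiv_apply Q₂]

omit [Module.Finite ℚ V₁] [Module.Finite ℚ V₂] in
/-- `(-1)ⁿ · (-1)ⁿ = 1` in `ℚ`. Private plumbing. [folklore] -/
private theorem negOnePow_ratCast_mul_self'' :
    (((n.negOnePow : ℤˣ) : ℤ) : ℚ) * (((n.negOnePow : ℤˣ) : ℤ) : ℚ) = 1 := by
  rw [← Int.cast_mul, ← Units.val_mul, Int.units_mul_self, Units.val_one, Int.cast_one]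

/-- **The involution of `Q₁ ⊕ Q₂` on an off-diagonal block: `(inr ∘ c ∘ fst)† = inl ∘ cᵗ ∘ snd`** — for `c : V₁ → V₂`,
`(Q₁ ⊕ Q₂)((0, c v), (v′, w′)) = Q₂(c v, w′) = Q₁(v, cᵗ w′) = (Q₁ ⊕ Q₂)((v, w), (cᵗ w′, 0))` (both `Qᵢ` have parity
`(-1)ⁿ`). Any weight. [cite: Milne1999LefschetzClasses, §1 p. 643 L21–L27] [cite: Lange2023AbelianVarietiesComplex, §2.4.2 Prop. 2.4.12 (chunk p0118)] -/
theorem Polarization.adjoint_prod_inr_comp_comp_fst (c : V₁ →ₗ[ℚ] V₂) :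
    (Q₁.prod Q₂).adjoint (LinearMap.inr ℚ V₁ V₂ ∘ₗ c ∘ₗ LinearMap.fst ℚ V₁ V₂) =
      LinearMap.inl ℚ V₁ V₂ ∘ₗ ((Q₁.toDualEquiv.symm : Module.Dual ℚ V₁ →ₗ[ℚ] V₁) ∘ₗ c.dualMap ∘ₗ
        (Q₂.toDualEquiv : V₂ →ₗ[ℚ] Module.Dual ℚ V₂)) ∘ₗ LinearMap.snd ℚ V₁ V₂ := by
  refine ((Q₁.prod Q₂).eq_adjoint_of_isAdjointPair fun x y ↦ ?_).symm
  rw [Polarization.prod_form_apply, Polarization.prod_form_apply]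
  simp only [LinearMap.comp_apply, LinearMap.fst_apply, LinearMap.snd_apply, LinearMap.inl_apply, LinearMap.inr_apply,
    LinearEquiv.coe_coe, map_zero, LinearMap.zero_apply, zero_add, add_zero]
  rw [Q₁.form_swap, Q₁.form_toDualEquiv_symm_dualMap_toDualEquiv_apply Q₂, Q₂.form_swap (c x.1) y.2, ← mul_assoc,
    negOnePow_ratCast_mul_self'', one_mul]

/-- The involution of `Q₁ ⊕ Q₂` on the `(1,1)`-block: `(inl ∘ a ∘ fst)† = inl ∘ a† ∘ fst` (g18-#4 `adjoint_prod_prodMap` with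
`(a, 0)`). [cite: Milne1999LefschetzClasses, §1 p. 643 L21–L27] -/
theorem Polarization.adjoint_prod_inl_comp_comp_fst (a : Module.End ℚ V₁) :
    (Q₁.prod Q₂).adjoint (LinearMap.inl ℚ V₁ V₂ ∘ₗ a ∘ₗ LinearMap.fst ℚ V₁ V₂) =
      LinearMap.inl ℚ V₁ V₂ ∘ₗ Q₁.adjoint a ∘ₗ LinearMap.fst ℚ V₁ V₂ := by
  have h : ∀ b : Module.End ℚ V₁, LinearMap.inl ℚ V₁ V₂ ∘ₗ b ∘ₗ LinearMap.fst ℚ V₁ V₂ = LinearMap.prodMap b 0 := fun b ↦ by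
    refine LinearMap.ext fun x ↦ ?_
    rw [LinearMap.comp_apply, LinearMap.comp_apply, LinearMap.fst_apply, LinearMap.inl_apply, LinearMap.prodMap_apply,
      LinearMap.zero_apply]
  rw [h, h, Q₁.adjoint_prod_prodMap Q₂, Q₂.adjoint_zero]

/-- The involution of `Q₁ ⊕ Q₂` on the `(2,2)`-block: `(inr ∘ d ∘ snd)† = inr ∘ d† ∘ snd`. [cite: Milne1999LefschetzClasses, §1 p. 643 L21–L27] -/
theorem Polarization.adjoint_prod_inr_comp_comp_snd (d : Module.End ℚ V₂) :
    (Q₁.prod Q₂).adjoint (LinearMap.inr ℚ V₁ V₂ ∘ₗ d ∘ₗ LinearMap.snd ℚ V₁ V₂) =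
      LinearMap.inr ℚ V₁ V₂ ∘ₗ Q₂.adjoint d ∘ₗ LinearMap.snd ℚ V₁ V₂ := by
  have h : ∀ b : Module.End ℚ V₂, LinearMap.inr ℚ V₁ V₂ ∘ₗ b ∘ₗ LinearMap.snd ℚ V₁ V₂ = LinearMap.prodMap 0 b := fun b ↦ by
    refine LinearMap.ext fun x ↦ ?_
    rw [LinearMap.comp_apply, LinearMap.comp_apply, LinearMap.snd_apply, LinearMap.inr_apply, LinearMap.prodMap_apply,
      LinearMap.zero_apply]
  rw [h, h, Q₁.adjoint_prod_prodMap Q₂, Q₁.adjoint_zero]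

/-! ### §2 The `†`-symmetric Hodge endomorphisms of `H₁ ⊕ H₂` in blocks -/

/-- The `(1,1)`-block of a `†`-symmetric Hodge endomorphism of `H₁ ⊕ H₂` is a `†`-symmetric Hodge endomorphism of `H₁`
(`Q₁(a₁₁ v, v′) = Q((s(v,0)), (v′,0)) = Q((v,0), s(v′,0)) = Q₁(v, a₁₁ v′)`). Any weight.
[cite: Lange2023AbelianVarietiesComplex, §2.4.2 Prop. 2.4.12 (chunk p0118)] [cite: DeligneHodgeII1971, 2.1] -/
theorem Polarization.fst_comp_comp_inl_mem_span_of_mem_span_prod {s : Module.End ℚ (V₁ × V₂)}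
    (hs : s ∈ Submodule.span ℚ {a : Module.End ℚ (V₁ × V₂) | a ∈ (H₁.prod H₂).endAlg ∧ (Q₁.prod Q₂).adjoint a = a}) :
    LinearMap.fst ℚ V₁ V₂ ∘ₗ s ∘ₗ LinearMap.inl ℚ V₁ V₂ ∈
      Submodule.span ℚ {a : Module.End ℚ V₁ | a ∈ H₁.endAlg ∧ Q₁.adjoint a = a} := by
  obtain ⟨hsE, hs'⟩ := ((Q₁.prod Q₂).mem_span_setOf_mem_endAlg_and_adjoint_eq_iff s).1 hs
  refine Submodule.subset_span ⟨fst_comp_comp_inl_mem_endAlg H₁ H₂ hsE, ?_⟩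
  refine (Q₁.eq_adjoint_of_isAdjointPair fun v v' ↦ ?_).symm
  have h := (Q₁.prod Q₂).form_apply_adjoint s (v, 0) (v', 0)
  rw [hs', Polarization.prod_form_apply, Polarization.prod_form_apply] at h
  simpa only [LinearMap.comp_apply, LinearMap.fst_apply, LinearMap.inl_apply, map_zero, LinearMap.zero_apply, add_zero]
    using h.symm

/-- The `(2,2)`-block of a `†`-symmetric Hodge endomorphism of `H₁ ⊕ H₂` is a `†`-symmetric Hodge endomorphism of `H₂`. Any
weight. [cite: Lange2023AbelianVarietiesComplex, §2.4.2 Prop. 2.4.12 (chunk p0118)] [cite: DeligneHodgeII1971, 2.1] -/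
theorem Polarization.snd_comp_comp_inr_mem_span_of_mem_span_prod {s : Module.End ℚ (V₁ × V₂)}
    (hs : s ∈ Submodule.span ℚ {a : Module.End ℚ (V₁ × V₂) | a ∈ (H₁.prod H₂).endAlg ∧ (Q₁.prod Q₂).adjoint a = a}) :
    LinearMap.snd ℚ V₁ V₂ ∘ₗ s ∘ₗ LinearMap.inr ℚ V₁ V₂ ∈
      Submodule.span ℚ {a : Module.End ℚ V₂ | a ∈ H₂.endAlg ∧ Q₂.adjoint a = a} := by
  obtain ⟨hsE, hs'⟩ := ((Q₁.prod Q₂).mem_span_setOf_mem_endAlg_and_adjoint_eq_iff s).1 hs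
  refine Submodule.subset_span ⟨snd_comp_comp_inr_mem_endAlg H₁ H₂ hsE, ?_⟩
  refine (Q₂.eq_adjoint_of_isAdjointPair fun w w' ↦ ?_).symm
  have h := (Q₁.prod Q₂).form_apply_adjoint s (0, w) (0, w')
  rw [hs', Polarization.prod_form_apply, Polarization.prod_form_apply] at h
  simpa only [LinearMap.comp_apply, LinearMap.snd_apply, LinearMap.inr_apply, map_zero, LinearMap.zero_apply, zero_add]
    using h.symm

/-- **The `(1,2)`-block of a `†`-symmetric Hodge endomorphism is the transpose of its `(2,1)`-block**: `s₁₂ = (s₂₁)ᵗ`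
(`Q₂(s₂₁ v, w′) = Q₁(v, s₁₂ w′)`, non-degeneracy of `Q₁`). Any weight.
[cite: Lange2023AbelianVarietiesComplex, §2.4.2 Prop. 2.4.12 (chunk p0118)] [cite: Milne1999LefschetzClasses, §1 p. 643 L21–L27] -/
theorem Polarization.fst_comp_comp_inr_eq_of_mem_span_prod {s : Module.End ℚ (V₁ × V₂)}
    (hs : s ∈ Submodule.span ℚ {a : Module.End ℚ (V₁ × V₂) | a ∈ (H₁.prod H₂).endAlg ∧ (Q₁.prod Q₂).adjoint a = a}) :
    LinearMap.fst ℚ V₁ V₂ ∘ₗ s ∘ₗ LinearMap.inr ℚ V₁ V₂ =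
      (Q₁.toDualEquiv.symm : Module.Dual ℚ V₁ →ₗ[ℚ] V₁) ∘ₗ (LinearMap.snd ℚ V₁ V₂ ∘ₗ s ∘ₗ LinearMap.inl ℚ V₁ V₂).dualMap ∘ₗ
        (Q₂.toDualEquiv : V₂ →ₗ[ℚ] Module.Dual ℚ V₂) := by
  obtain ⟨-, hs'⟩ := ((Q₁.prod Q₂).mem_span_setOf_mem_endAlg_and_adjoint_eq_iff s).1 hs
  refine LinearMap.ext fun w' ↦ ?_
  -- test against `Q₁(·, v)` for all `v`, in the swapped form `Q₁(x, v) = Q₁(y, v)`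
  have key : ∀ v, Q₁.form ((LinearMap.fst ℚ V₁ V₂ ∘ₗ s ∘ₗ LinearMap.inr ℚ V₁ V₂) w') v =
      Q₂.form w' ((LinearMap.snd ℚ V₁ V₂ ∘ₗ s ∘ₗ LinearMap.inl ℚ V₁ V₂) v) := fun v ↦ by
    have h := (Q₁.prod Q₂).form_apply_adjoint s (0, w') (v, 0)
    rw [hs', Polarization.prod_form_apply, Polarization.prod_form_apply] at h
    simpa only [LinearMap.comp_apply, LinearMap.fst_apply, LinearMap.snd_apply, LinearMap.inl_apply, LinearMap.inr_apply,
      map_zero, LinearMap.zero_apply, zero_add, add_zero] using h.symm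
  rw [← sub_eq_zero]
  refine Q₁.nondegenerate.1 _ fun v ↦ ?_
  rw [map_sub, LinearMap.sub_apply, key, Q₁.form_toDualEquiv_symm_dualMap_toDualEquiv Q₂, sub_self]

/-- **`Eˢ(H₁ ⊕ H₂) ≅ (Eˢ(H₁) × Eˢ(H₂)) × Hom(H₁, H₂)`, `ℚ`-linearly**: the map `((a, d), c) ↦ (a, cᵗ; c, d) =
inl a fst + inr d snd + ĉ + ĉ†`, `ĉ = inr ∘ c ∘ fst`, is a `ℚ`-linear isomorphism onto the `†`-symmetric Hodge endomorphisms of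
the direct sum (into: the four blocks are Hodge morphisms, g18-#3, and `(x + x†)† = x + x†`; injective and onto by the three
block lemmas above and the block decomposition). Any weight.
[cite: Lange2023AbelianVarietiesComplex, §2.4.2 Prop. 2.4.12 (chunk p0118)] [cite: HulekLaface2019PicardNumbersAV, §2.1 Prop. 2.2 (proof)] -/
theorem Polarization.exists_linearEquiv_span_prod :
    ∃ e : (((Submodule.span ℚ {a : Module.End ℚ V₁ | a ∈ H₁.endAlg ∧ Q₁.adjoint a = a}) ×
        (Submodule.span ℚ {a : Module.End ℚ V₂ | a ∈ H₂.endAlg ∧ Q₂.adjoint a = a})) × Hom H₁ H₂) ≃ₗ[ℚ]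
          Submodule.span ℚ {a : Module.End ℚ (V₁ × V₂) | a ∈ (H₁.prod H₂).endAlg ∧ (Q₁.prod Q₂).adjoint a = a},
      ∀ x : ((Submodule.span ℚ {a : Module.End ℚ V₁ | a ∈ H₁.endAlg ∧ Q₁.adjoint a = a}) ×
          (Submodule.span ℚ {a : Module.End ℚ V₂ | a ∈ H₂.endAlg ∧ Q₂.adjoint a = a})) × Hom H₁ H₂,
        ((e x : Submodule.span ℚ {a : Module.End ℚ (V₁ × V₂) | a ∈ (H₁.prod H₂).endAlg ∧ (Q₁.prod Q₂).adjoint a = a}) :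
          Module.End ℚ (V₁ × V₂)) =
        LinearMap.inl ℚ V₁ V₂ ∘ₗ (x.1.1 : Module.End ℚ V₁) ∘ₗ LinearMap.fst ℚ V₁ V₂ +
          LinearMap.inr ℚ V₁ V₂ ∘ₗ (x.1.2 : Module.End ℚ V₂) ∘ₗ LinearMap.snd ℚ V₁ V₂ +
          LinearMap.inr ℚ V₁ V₂ ∘ₗ x.2.toLinearMap ∘ₗ LinearMap.fst ℚ V₁ V₂ +
          (Q₁.prod Q₂).adjoint (LinearMap.inr ℚ V₁ V₂ ∘ₗ x.2.toLinearMap ∘ₗ LinearMap.fst ℚ V₁ V₂) := by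
  -- the raw linear map into `End(V₁ × V₂)`
  let g : ((Submodule.span ℚ {a : Module.End ℚ V₁ | a ∈ H₁.endAlg ∧ Q₁.adjoint a = a}) ×
      (Submodule.span ℚ {a : Module.End ℚ V₂ | a ∈ H₂.endAlg ∧ Q₂.adjoint a = a})) × Hom H₁ H₂ →ₗ[ℚ]
        Module.End ℚ (V₁ × V₂) :=
    { toFun := fun x ↦ LinearMap.inl ℚ V₁ V₂ ∘ₗ (x.1.1 : Module.End ℚ V₁) ∘ₗ LinearMap.fst ℚ V₁ V₂ +
          LinearMap.inr ℚ V₁ V₂ ∘ₗ (x.1.2 : Module.End ℚ V₂) ∘ₗ LinearMap.snd ℚ V₁ V₂ +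
          LinearMap.inr ℚ V₁ V₂ ∘ₗ x.2.toLinearMap ∘ₗ LinearMap.fst ℚ V₁ V₂ +
          (Q₁.prod Q₂).adjoint (LinearMap.inr ℚ V₁ V₂ ∘ₗ x.2.toLinearMap ∘ₗ LinearMap.fst ℚ V₁ V₂)
      map_add' := fun x y ↦ by
        simp only [Prod.fst_add, Prod.snd_add, Submodule.coe_add, Hom.add_toLinearMap, LinearMap.add_comp,
          LinearMap.comp_add, Polarization.adjoint_add]
        abel
      map_smul' := fun c x ↦ by
        simp only [Prod.smul_fst, Prod.smul_snd, Submodule.coe_smul, Hom.smul_toLinearMap, LinearMap.smul_comp,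
          LinearMap.comp_smul, Polarization.adjoint_smul, RingHom.id_apply, smul_add] }
  have hg : ∀ x, g x = LinearMap.inl ℚ V₁ V₂ ∘ₗ (x.1.1 : Module.End ℚ V₁) ∘ₗ LinearMap.fst ℚ V₁ V₂ +
      LinearMap.inr ℚ V₁ V₂ ∘ₗ (x.1.2 : Module.End ℚ V₂) ∘ₗ LinearMap.snd ℚ V₁ V₂ +
      LinearMap.inr ℚ V₁ V₂ ∘ₗ x.2.toLinearMap ∘ₗ LinearMap.fst ℚ V₁ V₂ +
      (Q₁.prod Q₂).adjoint (LinearMap.inr ℚ V₁ V₂ ∘ₗ x.2.toLinearMap ∘ₗ LinearMap.fst ℚ V₁ V₂) := fun _ ↦ rfl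
  -- the blocks of `g x`
  have hb : ∀ x, LinearMap.fst ℚ V₁ V₂ ∘ₗ g x ∘ₗ LinearMap.inl ℚ V₁ V₂ = (x.1.1 : Module.End ℚ V₁) ∧
      LinearMap.snd ℚ V₁ V₂ ∘ₗ g x ∘ₗ LinearMap.inr ℚ V₁ V₂ = (x.1.2 : Module.End ℚ V₂) ∧
      LinearMap.snd ℚ V₁ V₂ ∘ₗ g x ∘ₗ LinearMap.inl ℚ V₁ V₂ = x.2.toLinearMap := fun x ↦ by
    rw [hg, Q₁.adjoint_prod_inr_comp_comp_fst Q₂]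
    refine ⟨LinearMap.ext fun v ↦ ?_, LinearMap.ext fun w ↦ ?_, LinearMap.ext fun v ↦ ?_⟩ <;>
      simp only [LinearMap.comp_apply, LinearMap.add_apply, LinearMap.fst_apply, LinearMap.snd_apply, LinearMap.inl_apply,
        LinearMap.inr_apply, map_zero, Prod.fst_add, Prod.snd_add, add_zero, zero_add]
  -- into `Eˢ(H₁ ⊕ H₂)`
  have hmem : ∀ x, g x ∈ Submodule.span ℚ {a : Module.End ℚ (V₁ × V₂) | a ∈ (H₁.prod H₂).endAlg ∧
      (Q₁.prod Q₂).adjoint a = a} := fun x ↦ by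
    obtain ⟨ha, ha'⟩ := (Q₁.mem_span_setOf_mem_endAlg_and_adjoint_eq_iff (x.1.1 : Module.End ℚ V₁)).1 x.1.1.2
    obtain ⟨hd, hd'⟩ := (Q₂.mem_span_setOf_mem_endAlg_and_adjoint_eq_iff (x.1.2 : Module.End ℚ V₂)).1 x.1.2.2
    have hc : LinearMap.inr ℚ V₁ V₂ ∘ₗ x.2.toLinearMap ∘ₗ LinearMap.fst ℚ V₁ V₂ ∈ (H₁.prod H₂).endAlg :=
      inr_comp_hom_comp_fst_mem_endAlg_prod H₁ H₂ x.2
    refine Submodule.subset_span ⟨?_, ?_⟩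
    · rw [hg]
      exact Subalgebra.add_mem _ (Subalgebra.add_mem _ (Subalgebra.add_mem _
        (inl_comp_comp_fst_mem_endAlg_prod H₁ H₂ ha) (inr_comp_comp_snd_mem_endAlg_prod H₁ H₂ hd)) hc)
        ((Q₁.prod Q₂).adjoint_mem_endAlg hc)
    · rw [hg, Polarization.adjoint_add, Polarization.adjoint_add, Polarization.adjoint_add, Polarization.adjoint_adjoint,
        Q₁.adjoint_prod_inl_comp_comp_fst Q₂, Q₁.adjoint_prod_inr_comp_comp_snd Q₂, ha', hd']
      abel
  refine ⟨LinearEquiv.ofBijective (LinearMap.codRestrict _ g hmem) ⟨fun x y hxy ↦ ?_, fun s ↦ ?_⟩, fun x ↦ rfl⟩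
  · -- injective: compare the three free blocks
    have h : g x = g y := congrArg Subtype.val hxy
    obtain ⟨hx₁, hx₂, hx₃⟩ := hb x
    obtain ⟨hy₁, hy₂, hy₃⟩ := hb y
    rw [h] at hx₁ hx₂ hx₃
    exact Prod.ext (Prod.ext (Subtype.ext (hx₁.symm.trans hy₁)) (Subtype.ext (hx₂.symm.trans hy₂)))
      (Hom.toLinearMap_injective (hx₃.symm.trans hy₃))
  · -- surjective: the blocks of a `†`-symmetric Hodge endomorphism
    obtain ⟨hsE, -⟩ := ((Q₁.prod Q₂).mem_span_setOf_mem_endAlg_and_adjoint_eq_iff (s : Module.End ℚ (V₁ × V₂))).1 s.2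
    obtain ⟨c, hc⟩ := exists_hom_toLinearMap_eq_snd_comp_comp_inl H₁ H₂ hsE
    refine ⟨((⟨_, Q₁.fst_comp_comp_inl_mem_span_of_mem_span_prod Q₂ s.2⟩,
      ⟨_, Q₁.snd_comp_comp_inr_mem_span_of_mem_span_prod Q₂ s.2⟩), c), Subtype.ext ?_⟩
    rw [LinearMap.codRestrict_apply, hg]
    dsimp only
    rw [hc, Q₁.adjoint_prod_inr_comp_comp_fst Q₂, ← Q₁.fst_comp_comp_inr_eq_of_mem_span_prod Q₂ s.2]
    conv_rhs => rw [eq_sum_blocks (s : Module.End ℚ (V₁ × V₂))]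
    abel

/-- **`dim_ℚ Eˢ(H₁ ⊕ H₂) = dim_ℚ Eˢ(H₁) + dim_ℚ Eˢ(H₂) + dim_ℚ Hom_HS(H₁, H₂)`** (any weight).
[cite: Lange2023AbelianVarietiesComplex, §2.4.2 Prop. 2.4.12 (chunk p0118)] [cite: HulekLaface2019PicardNumbersAV, §2.1 Prop. 2.2 and Cor. 2.3] -/
theorem Polarization.finrank_span_prod :
    Module.finrank ℚ (Submodule.span ℚ {a : Module.End ℚ (V₁ × V₂) | a ∈ (H₁.prod H₂).endAlg ∧ (Q₁.prod Q₂).adjoint a = a}) =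
      Module.finrank ℚ (Submodule.span ℚ {a : Module.End ℚ V₁ | a ∈ H₁.endAlg ∧ Q₁.adjoint a = a}) +
        Module.finrank ℚ (Submodule.span ℚ {a : Module.End ℚ V₂ | a ∈ H₂.endAlg ∧ Q₂.adjoint a = a}) +
        Module.finrank ℚ (Hom H₁ H₂) := by
  haveI : Module.Finite ℚ (Hom H₁ H₂) :=
    Module.Finite.of_injective ({ toFun := Hom.toLinearMap, map_add' := fun _ _ ↦ rfl, map_smul' := fun _ _ ↦ rfl } :
      Hom H₁ H₂ →ₗ[ℚ] (V₁ →ₗ[ℚ] V₂)) Hom.toLinearMap_injective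
  obtain ⟨e, -⟩ := Q₁.exists_linearEquiv_span_prod Q₂
  rw [← e.finrank_eq, Module.finrank_prod, Module.finrank_prod]

/-! ### §3 The Picard number of a direct sum -/

include Q₁ Q₂ in
/-- **`ρ(H₁ ⊕ H₂) = ρ(H₁) + ρ(H₂) + dim_ℚ Hom_HS(H₁, H₂)`** for polarized `ℚ`-Hodge structures of the same odd weight: the
degree-two Hodge classes of type `(n, n)` of `⋀²(H₁ ⊕ H₂)` versus those of `⋀² H₁`, `⋀² H₂` ("`ρ(X₁ × X₂) = ρ(X₁) + ρ(X₂) +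
rank Hom(X₁, X₂)`"; g26-#3's `ρ = dim Eˢ` three times and §2). [cite: Lange2023AbelianVarietiesComplex, §2.4.2 Prop. 2.4.12 (a) (chunk p0118)]
[cite: HulekLaface2019PicardNumbersAV, §2.1 Prop. 2.2 and Cor. 2.3 (the case Hom = 0; `E × E`: ρ ∈ {3, 4})] -/
theorem Polarization.finrank_hodgeClasses_two_prod (hn : Odd n) :
    Module.finrank ℚ (((H₁.prod H₂).exteriorPower 2).hodgeClasses n) =
      Module.finrank ℚ ((H₁.exteriorPower 2).hodgeClasses n) + Module.finrank ℚ ((H₂.exteriorPower 2).hodgeClasses n) +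
        Module.finrank ℚ (Hom H₁ H₂) := by
  rw [(Q₁.prod Q₂).finrank_hodgeClasses_two_eq hn, Q₁.finrank_hodgeClasses_two_eq hn, Q₂.finrank_hodgeClasses_two_eq hn,
    Q₁.finrank_span_prod Q₂]

include Q₁ Q₂ in
/-- **Additivity for `Hom(H₁, H₂) = 0`** (Hulek–Laface Cor. 2.3, two factors: non-isogenous simple factors have `Hom = 0`):
`ρ(H₁ ⊕ H₂) = ρ(H₁) + ρ(H₂)` (odd weight). [cite: HulekLaface2019PicardNumbersAV, §2.1 Prop. 2.2 and Cor. 2.3] -/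
theorem Polarization.finrank_hodgeClasses_two_prod_of_subsingleton_hom (hn : Odd n) [Subsingleton (Hom H₁ H₂)] :
    Module.finrank ℚ (((H₁.prod H₂).exteriorPower 2).hodgeClasses n) =
      Module.finrank ℚ ((H₁.exteriorPower 2).hodgeClasses n) + Module.finrank ℚ ((H₂.exteriorPower 2).hodgeClasses n) := by
  rw [Q₁.finrank_hodgeClasses_two_prod Q₂ hn, (Module.finrank_zero_of_subsingleton : Module.finrank ℚ (Hom H₁ H₂) = 0),
    add_zero]

include Q₁ in
/-- **`ρ(H ⊕ H) = 2ρ(H) + dim_ℚ E_φ(H)`** (odd weight) — for an elliptic curve `E`: `ρ(E × E) = 2 + rank End(E) ∈ {3, 4}`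
"depending on the presence of CM". [cite: HulekLaface2019PicardNumbersAV, §2.1 (`E × E` has Picard number ρ ∈ {3, 4})]
[cite: Lange2023AbelianVarietiesComplex, §2.4.2 Prop. 2.4.12 (a) (chunk p0118)] -/
theorem Polarization.finrank_hodgeClasses_two_prod_self (hn : Odd n) :
    Module.finrank ℚ (((H₁.prod H₁).exteriorPower 2).hodgeClasses n) =
      2 * Module.finrank ℚ ((H₁.exteriorPower 2).hodgeClasses n) + Module.finrank ℚ H₁.endAlg := by
  rw [Q₁.finrank_hodgeClasses_two_prod Q₁ hn, ← finrank_endAlg_eq_finrank_hom, two_mul]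

end HodgeStructure

end Literature.AlgebraicGeometry.Motives
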